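import Literature.Topology.FourManifolds.SurfaceCappingOrientation
import Literature.Topology.FourManifolds.SurfaceFirstBettiEven
import Literature.Topology.FourManifolds.SurfaceGenusParity
import Literature.Topology.FourManifolds.IntersectionLatticeOrientationProofs
import Literature.Topology.FourManifolds.SliceGenusDiscMorseProofs
import Literature.AlgebraicTopology.Homotopy.CollarPush
import Literature.AlgebraicTopology.SingularHomology.MayerVietorisExactness
import Literature.AlgebraicTopology.SingularHomology.ExcisionMayerVietorisProofs
import Literature.AlgebraicTopology.SingularHomology.ExcisionTheorem
import Literature.AlgebraicTopology.SingularHomology.SphereHomology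
import Literature.AlgebraicTopology.SingularHomology.TripleSequence
import Literature.AlgebraicTopology.SingularHomology.NoncompactManifoldProofs
import Literature.AlgebraicTopology.SingularHomology.FundamentalClassExistence
import Literature.AlgebraicTopology.SingularHomology.BoundaryManifoldFiniteness
import Literature.AlgebraicTopology.SingularHomology.CompactManifoldFiniteness
import Mathlib.Analysis.Convex.Contractible
import Mathlib.Analysis.Normed.Module.Connected
import HarnessLib

/-!
# The first Betti number of an orientable surface with one boundary circle is even — proof

Topic `Literature/Topology/FourManifolds`; fact seat
`provefact-Literature.Topology.FourManifolds.Knot.sliceGenus_eq_zero_iff`.  This file **discharges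
the named fact** `Literature.Topology.FourManifolds.even_finrank_singularHomology_one_of_boundary_circle`
(`SurfaceGenusParity.lean`; the parity clause of M. W. Hirsch, *Differential Topology* (1976),
Ch. 9 §3, Thm. 3.7 for one boundary circle: *the first Betti number of a compact connected
orientable surface `S` with `∂S ≅ 𝕊¹` is even*), by the classical reduction to the closed case
("attach disks to `∂M` to get a closed surface", Hirsch, proof of Thm. 3.7; Massey, *A Basic
Course in Algebraic Topology* (1991), Ch. I §10):

1. cap the boundary circle with a disc, `P = S ∪_φ 𝔻²` (`CapData.P`, `SurfaceCapping.lean`), a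
   closed connected smooth surface, orientable when `S` is (`CapData.isOrientable_P`,
   `SurfaceCappingOrientation.lean`), hence homologically `ℤ`-oriented (the tree's bridge
   `isOrientableOver_int_of_isOrientable_holds`, Bredon VI.7.15), so that `rank H₁(P; ℤ)` is even
   by Poincaré duality (`even_finrank_singularHomology_one_of_orientation`,
   `SurfaceFirstBettiEven.lean`; Hatcher Cor. 3.39);
2. **`rank H₁(P; ℤ) = rank H₁(S; ℤ)`** (this file, `CapData.finrank_singularHomology_one_eq`):
   Mayer–Vietoris (Hatcher §2.2, exactness proved in the tree, `…MayerVietorisExactness`) for the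
   open cover `P = U ∪ V` by `U = jS(S) ∪ (seam collar of height < 1)` and the open disc
   `V = 𝔻² ∖ ∂𝔻²`, with `U ∩ V ≃ ∂S × (-1, 0) ≃ 𝕊¹`:
   `0 = H₂(U) ⊕ H₂(V) → H₂(P) ≅ ℤ → H₁(U ∩ V) ≅ ℤ → H₁(U) ⊕ 0 → H₁(P) → 0`, the last zero because
   `H₀(U ∩ V) → H₀(U)` is injective (`U ∩ V` path connected); here `H₂(U) = 0` by Hatcher
   Prop. 3.29 (`U` is a connected non-compact surface, `isZero_singularHomology_of_noncompactSpace_holds`),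
   `H₂(P) ≅ ℤ` by Hatcher Thm. 3.26 (`nonempty_singularHomology_top_iso_holds`), and
   `H₁(U) ≅ H₁(S)` because `jS(S)` is a deformation retract of `U` — both `jS(S)` (the core) and
   `U` (the interior) are deformation retracts of `W = jS(S) ∪ (closed seam collar of height 1)`
   along the pushes of the topological boundary collar `(z, s) ↦ seam (z, s - 1)` of `W`
   (`Literature.AlgebraicTopology.Homotopy.BoundaryCollar`, Hatcher Prop. 3.42); counting ranks
   (`finrank_add_finrank_eq_of_exact₄`, Hatcher Thm. 2.44) gives the claim.

Everything is proved; no named facts are introduced.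

## Main results

* `Literature.Topology.FourManifolds.CapData.finrank_singularHomology_one_eq` — for the capped
  surface `P` of a compact connected surface `S` with one boundary circle,
  `rank_ℤ H₁(P; ℤ) = rank_ℤ H₁(S; ℤ)`;
* **`Literature.Topology.FourManifolds.even_finrank_singularHomology_one_of_boundary_circle_holds`**
  — discharge of the named fact (Hirsch 1976, Ch. 9 §3, Thm. 3.7, `k = 1`).

## References

* M. W. Hirsch, *Differential Topology*, GTM 33 (1976), Ch. 9 §3, Thm. 3.7 and its proof.
  [HirschDT1976]
* A. Hatcher, *Algebraic Topology*, CUP (2002), §2.2 (Mayer–Vietoris, pp. 149–150), Thm. 2.44,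
  §3.3 Thm. 3.26, Prop. 3.29, Prop. 3.42, Cor. 3.39. [HatcherAT2002]
* W. S. Massey, *A Basic Course in Algebraic Topology*, GTM 127 (1991), Ch. I §10 (capping
  the boundary circles of a bordered surface).
-/

noncomputable section

open Set Function CategoryTheory Limits
open scoped Manifold ContDiff Topology unitInterval ContinuousMap
open Literature.AlgebraicTopology.SingularHomology Literature.AlgebraicTopology.Homotopy

namespace Literature.Topology.FourManifolds

/-- Local notation: `𝔼 n` is the model Euclidean space `EuclideanSpace ℝ (Fin n)`. -/
local notation "𝔼 " n:arg => EuclideanSpace ℝ (Fin n)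

/-- Local notation: `𝕊 n` is the unit sphere in `EuclideanSpace ℝ (Fin (n + 1))`. -/
local notation "𝕊 " n:arg => (Metric.sphere (0 : EuclideanSpace ℝ (Fin (n + 1))) 1)

/-- Local notation: `𝔻 n` is the closed unit ball in `EuclideanSpace ℝ (Fin n)`. -/
local notation "𝔻 " n:arg => (Metric.closedBall (0 : EuclideanSpace ℝ (Fin n)) 1)

/-! ### Small algebraic lemmas -/

section Algebra

/-- The biproduct with a zero module does not change the rank. [folklore] -/
theorem finrank_biprod_of_isZero_right {A B : ModuleCat.{0} ℤ} (hB : IsZero B) :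
    Module.finrank ℤ (A ⊞ B : ModuleCat.{0} ℤ) = Module.finrank ℤ A := by
  haveI : Subsingleton B := ModuleCat.subsingleton_of_isZero hB
  haveI : Unique B := uniqueOfSubsingleton 0
  exact ((ModuleCat.biprodIsoProd A B).toLinearEquiv.trans
    (LinearEquiv.prodUnique (R := ℤ) (M := A) (M₂ := B))).finrank_eq

/-- The biproduct of two finitely generated modules is finitely generated. [folklore] -/
theorem moduleFinite_biprod {A B : ModuleCat.{0} ℤ} [Module.Finite ℤ A] [Module.Finite ℤ B] :
    Module.Finite ℤ (A ⊞ B : ModuleCat.{0} ℤ) := by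
  refine ⟨Submodule.fg_of_fg_map_of_fg_inf_ker (biprod.snd : A ⊞ B ⟶ B).hom ?_ ?_⟩
  · exact IsNoetherian.noetherian _
  · rw [top_inf_eq]
    have h := (ShortComplex.Splitting.ofHasBinaryBiproduct A B).exact.moduleCat_range_eq_ker
    dsimp only at h
    rw [← h, LinearMap.range_eq_map]
    exact Module.Finite.fg_top.map _

/-- A module isomorphic (in `ModuleCat ℤ`) to `ULift ℤ` has rank one and is finitely generated.
[folklore] -/
theorem finrank_eq_one_of_iso_ulift {A : ModuleCat.{0} ℤ} (e : A ≅ ModuleCat.of ℤ (ULift.{0} ℤ)) :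
    Module.finrank ℤ A = 1 ∧ Module.Finite ℤ A := by
  have e' : A ≃ₗ[ℤ] ℤ := e.toLinearEquiv.trans ULift.moduleEquiv
  exact ⟨by rw [e'.finrank_eq, Module.finrank_self], Module.Finite.equiv e'.symm⟩

/-- The level `1/2` of the unit interval. [folklore] -/
def levelHalf : I := ⟨2⁻¹, by norm_num, by norm_num⟩

/-- `0 < 1/2` in the unit interval. [folklore] -/
theorem levelHalf_pos : (0 : I) < levelHalf := by
  show (0 : ℝ) < 2⁻¹
  norm_num

/-- `1/2 < 1` in the unit interval. [folklore] -/
theorem levelHalf_lt_one : levelHalf < (1 : I) := by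
  show (2⁻¹ : ℝ) < 1
  norm_num

end Algebra

/-! ### The open disc -/

section Disc

/-- **The interior of the closed disc is the open disc**: the interior `𝔻² ∖ ∂𝔻²` of the
manifold with boundary `𝔻²` (`InteriorManifold`), homeomorphically onto the open unit ball
(`interior_closedBall`). [folklore] -/
def interiorClosedBallHomeomorph :
    InteriorManifold (𝓡∂ 2) (𝔻 2) ≃ₜ ↥(Metric.ball (0 : 𝔼 2) 1) where
  toFun x := ⟨(x.val : 𝔼 2), mem_ball_zero_iff.2
    ((Set.ext_iff.1 (interior_closedBall (n := 1)) x.val).1 x.val_mem_interior)⟩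
  invFun y := ⟨⟨(y : 𝔼 2), Metric.ball_subset_closedBall y.2⟩,
    (Set.ext_iff.1 (interior_closedBall (n := 1)) _).2 (mem_ball_zero_iff.1 y.2)⟩
  left_inv _ := InteriorManifold.ext rfl
  right_inv _ := rfl
  continuous_toFun := (continuous_subtype_val.comp InteriorManifold.continuous_val).subtype_mk _
  continuous_invFun :=
    InteriorManifold.continuous_iff_comp_val.2 (continuous_subtype_val.subtype_mk _)

/-- The interior of the closed disc is contractible. [folklore] -/
theorem contractibleSpace_interior_closedBall : ContractibleSpace (InteriorManifold (𝓡∂ 2) (𝔻 2)) :=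
  haveI : ContractibleSpace ↥(Metric.ball (0 : 𝔼 2) 1) :=
    (convex_ball (0 : 𝔼 2) 1).contractibleSpace ⟨0, Metric.mem_ball_self one_pos⟩
  interiorClosedBallHomeomorph.contractibleSpace

end Disc

/-! ### The Mayer–Vietoris cover of the capped surface -/

section Cap

variable {S : Type} [TopologicalSpace S] [ChartedSpace (EuclideanHalfSpace 2) S]
  [IsManifold (𝓡∂ 2) ∞ S]

/-- The boundary of a compact `C^∞` surface with boundary is compact. [folklore] -/
private theorem compactSpace_boundary₂ [CompactSpace S] : CompactSpace ((𝓡∂ 2).boundary S) :=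
  isCompact_iff_compactSpace.1 (ModelWithCorners.isClosed_boundary (M := S) (n := ∞) (by simp) :
    IsClosed ((𝓡∂ 2).boundary S)).isCompact

variable (c : CapData S) [Nonempty ((𝓡∂ 2).boundary S)]

namespace CapData

/-! #### The seam `∂S × ℝ → P` and the pieces -/

/-- **The seam** of the capped surface: `(z, t) ↦ inl (inl (z, t))`, the open embedding of the
cylinder `∂S × ℝ` into `P = S ∪_φ 𝔻²` (heights `t ≥ 0` lie in `jS(S)`, heights `t < 0` in the
disc). [folklore] -/
def seam (p : ↥((𝓡∂ 2).boundary S) × ℝ) : c.P := c.G.d₂.inl (c.G.d₁.inl p)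

/-- The seam is continuous. [folklore] -/
theorem continuous_seam : Continuous c.seam :=
  c.G.d₂.continuous_inl.comp c.G.d₁.continuous_inl

/-- The seam is injective. [folklore] -/
theorem seam_injective : Injective c.seam :=
  c.G.d₂.inl_injective.comp c.G.d₁.inl_injective

/-- The seam is an open map. [folklore] -/
theorem isOpenMap_seam : IsOpenMap c.seam :=
  c.G.d₂.isOpenMap_inl.comp c.G.d₁.isOpenMap_inl

/-- `jS z = seam (z, 0)` on the boundary. [folklore] -/
theorem jS_coe (z : (𝓡∂ 2).boundary S) : c.jS (z : S) = c.seam (z, 0) := c.G.jM_incl z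

/-- **A seam point lies in `jS(S)` iff its height is `≥ 0`.** [folklore] -/
theorem seam_mem_range_jS_iff {p : ↥((𝓡∂ 2).boundary S) × ℝ} :
    c.seam p ∈ range c.jS ↔ 0 ≤ p.2 := by
  constructor
  · rintro ⟨a, ha⟩
    rcases BoundaryGlueData.exists_incl_or_isInteriorPoint
        (bM := BoundaryManifold.boundaryData 1 S) a with ⟨z, rfl⟩ | ha'
    · have h : c.seam (z, 0) = c.seam p := (c.G.jM_incl z).symm.trans ha
      obtain rfl : p = (z, 0) := (c.seam_injective h).symm
      exact le_rfl
    · have h : c.G.d₂.inl (c.G.d₁.inr ⟨a, ha'⟩) = c.seam p :=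
        (c.G.jM_of_isInteriorPoint ha').symm.trans ha
      have h' : p ∈ c.G.d₁.glue.source :=
        (c.G.d₁.inl_eq_inr_iff.1 (c.G.d₂.inl_injective h).symm).1
      have h'' : (0 : ℝ) < p.2 := h'
      exact le_of_lt h''
  · intro hp
    exact ⟨c.CS.toFun p.1 p.2, c.G.jM_toFun p.1 hp⟩

/-- A seam point lies in the open disc `inr (𝔻² ∖ ∂𝔻²)` iff its height is `< 0`. [folklore] -/
theorem seam_mem_range_inr_iff {p : ↥((𝓡∂ 2).boundary S) × ℝ} :
    c.seam p ∈ range c.G.d₂.inr ↔ p.2 < 0 := by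
  show c.G.d₂.inl (c.G.d₁.inl p) ∈ range c.G.d₂.inr ↔ p.2 < 0
  rw [c.G.d₂.inl_mem_range_inr_iff, c.G.d₂_glue]
  exact c.G.inl_mem_glue₂_source_iff

/-- A point `inl (inr x)` coming from the interior of `S` is not in the open disc. [folklore] -/
theorem inl_inr_not_mem_range_inr (x : InteriorManifold (𝓡∂ 2) S) :
    c.G.d₂.inl (c.G.d₁.inr x) ∉ range c.G.d₂.inr := by
  rintro ⟨y, hy⟩
  exact c.G.inl_inr_ne_inr x y hy.symm

/-- A point `inl (inr x)` coming from the interior of `S` is `jS x`. [folklore] -/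
theorem inl_inr_eq_jS (x : InteriorManifold (𝓡∂ 2) S) :
    c.G.d₂.inl (c.G.d₁.inr x) = c.jS x.val :=
  (c.G.jM_of_isInteriorPoint x.property).symm

/-- **The open disc piece** `V = inr (𝔻² ∖ ∂𝔻²) ⊆ P`. [folklore] -/
def discSet : Set c.P := range c.G.d₂.inr

/-- **The surface piece** `U = inl (inr (S ∖ ∂S)) ∪ seam (∂S × (-1, ∞)) ⊆ P`: the image `jS(S)`
thickened by the open seam collar of height `< 1` into the disc. [folklore] -/
def uSet : Set c.P := range (fun x => c.G.d₂.inl (c.G.d₁.inr x)) ∪ c.seam '' {p | -1 < p.2}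

/-- **The closed thickening** `W = jS(S) ∪ seam (∂S × [-1, 0]) ⊆ P` of the surface piece, on
which the seam collar `(z, s) ↦ seam (z, s - 1)` is a topological boundary collar. [folklore] -/
def wSet : Set c.P := range c.jS ∪ c.seam '' {p | -1 ≤ p.2 ∧ p.2 ≤ 0}

/-- `V` is open. [folklore] -/
theorem isOpen_discSet : IsOpen c.discSet := c.G.d₂.isOpen_range_inr

/-- `U` is open. [folklore] -/
theorem isOpen_uSet : IsOpen c.uSet :=
  (c.G.d₂.isOpenMap_inl.comp c.G.d₁.isOpenMap_inr).isOpen_range.union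
    (c.isOpenMap_seam _ (isOpen_lt continuous_const continuous_snd))

/-- `jS(S) ⊆ U`. [folklore] -/
theorem range_jS_subset_uSet : range c.jS ⊆ c.uSet := by
  rintro _ ⟨a, rfl⟩
  rcases BoundaryGlueData.exists_incl_or_isInteriorPoint
      (bM := BoundaryManifold.boundaryData 1 S) a with ⟨z, rfl⟩ | ha
  · refine Or.inr ⟨(z, 0), ?_, (c.G.jM_incl z).symm⟩
    show (-1 : ℝ) < 0
    norm_num
  · exact Or.inl ⟨⟨a, ha⟩, (c.G.jM_of_isInteriorPoint ha).symm⟩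

/-- `U = jS(S) ∪ seam (∂S × (-1, ∞))`. [folklore] -/
theorem uSet_eq : c.uSet = range c.jS ∪ c.seam '' {p | -1 < p.2} := by
  refine Subset.antisymm (union_subset_union_left _ ?_)
    (union_subset c.range_jS_subset_uSet subset_union_right)
  rintro _ ⟨x, rfl⟩
  exact ⟨x.val, (c.inl_inr_eq_jS x).symm⟩

/-- A seam point lies in `U` iff its height is `> -1`. [folklore] -/
theorem seam_mem_uSet_iff {p : ↥((𝓡∂ 2).boundary S) × ℝ} : c.seam p ∈ c.uSet ↔ -1 < p.2 := by
  constructor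
  · rintro (⟨x, hx⟩ | ⟨q, hq, hqp⟩)
    · have h' : p ∈ c.G.d₁.glue.source :=
        (c.G.d₁.inl_eq_inr_iff.1 (c.G.d₂.inl_injective hx).symm).1
      have h'' : (0 : ℝ) < p.2 := h'
      linarith
    · obtain rfl : q = p := c.seam_injective hqp
      exact hq
  · exact fun hp => Or.inr ⟨p, hp, rfl⟩

/-- `U ⊆ W`. [folklore] -/
theorem uSet_subset_wSet : c.uSet ⊆ c.wSet := by
  rw [c.uSet_eq]
  refine union_subset subset_union_left ?_
  rintro _ ⟨p, hp, rfl⟩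
  have hp' : (-1 : ℝ) < p.2 := hp
  rcases le_or_gt 0 p.2 with h | h
  · exact Or.inl (c.seam_mem_range_jS_iff.2 h)
  · exact Or.inr ⟨p, ⟨le_of_lt hp', le_of_lt h⟩, rfl⟩

/-- `jS(S) ⊆ W`. [folklore] -/
theorem range_jS_subset_wSet : range c.jS ⊆ c.wSet := subset_union_left

/-- The points of `W`: a point of `jS(S)`, or a seam point of height in `[-1, 0)`. [folklore] -/
theorem wSet_cases {x : c.P} (hx : x ∈ c.wSet) :
    x ∈ range c.jS ∨ ∃ p : ↥((𝓡∂ 2).boundary S) × ℝ, (-1 ≤ p.2 ∧ p.2 < 0) ∧ c.seam p = x := by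
  rcases hx with h | ⟨p, ⟨h1, h2⟩, rfl⟩
  · exact Or.inl h
  · rcases h2.lt_or_eq with h2 | h2
    · exact Or.inr ⟨p, ⟨h1, h2⟩, rfl⟩
    · exact Or.inl (c.seam_mem_range_jS_iff.2 h2.ge)

/-- **`U ∩ V` is the open seam collar `seam (∂S × (-1, 0))`.** [folklore] -/
theorem uSet_inter_discSet : c.uSet ∩ c.discSet = c.seam '' {p | -1 < p.2 ∧ p.2 < 0} := by
  ext x
  constructor
  · rintro ⟨hu | ⟨p, hp, rfl⟩, hv⟩
    · obtain ⟨y, rfl⟩ := hu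
      exact absurd hv (c.inl_inr_not_mem_range_inr y)
    · exact ⟨p, ⟨hp, c.seam_mem_range_inr_iff.1 hv⟩, rfl⟩
  · rintro ⟨p, ⟨h1, h2⟩, rfl⟩
    exact ⟨c.seam_mem_uSet_iff.2 h1, c.seam_mem_range_inr_iff.2 h2⟩

/-- **`U` and `V` cover `P`.** [folklore] -/
theorem uSet_union_discSet : c.uSet ∪ c.discSet = univ := by
  refine eq_univ_of_forall fun q => ?_
  obtain (⟨x, rfl⟩ | ⟨y, rfl⟩) := c.G.d₂.exists_inl_or_inr q
  · obtain (⟨p, rfl⟩ | ⟨a, rfl⟩) := c.G.d₁.exists_inl_or_inr x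
    · rcases lt_or_ge (-1 : ℝ) p.2 with h | h
      · exact Or.inl (c.seam_mem_uSet_iff.2 h)
      · exact Or.inr (c.seam_mem_range_inr_iff.2 (by linarith))
    · exact Or.inl (Or.inl ⟨a, rfl⟩)
  · exact Or.inr ⟨y, rfl⟩

/-- The interiors of `U` and `V` cover `P` (both are open). [folklore] -/
theorem interior_uSet_union_interior_discSet : interior c.uSet ∪ interior c.discSet = univ := by
  rw [c.isOpen_uSet.interior_eq, c.isOpen_discSet.interior_eq, c.uSet_union_discSet]

/-- `U ∩ V` is path connected (the image of `∂S × (-1, 0)`, `∂S ≅ 𝕊¹`). [folklore] -/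
theorem isPathConnected_inter : IsPathConnected (c.uSet ∩ c.discSet) := by
  rw [c.uSet_inter_discSet]
  have hsph := isPathConnected_sphere (E := 𝔼 2) (by
    rw [← Module.finrank_eq_rank, finrank_euclideanSpace_fin]; norm_num) (0 : 𝔼 2) zero_le_one
  have h𝕊 : IsPathConnected (univ : Set ↥(𝕊 1)) :=
    pathConnectedSpace_iff_univ.1 (isPathConnected_iff_pathConnectedSpace.1 hsph)
  have hA : IsPathConnected (univ : Set ↥((𝓡∂ 2).boundary S)) := by
    have := h𝕊.image c.φS.toHomeomorph.symm.continuous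
    rwa [image_univ_of_surjective c.φS.toHomeomorph.symm.surjective] at this
  have hset : {p : ↥((𝓡∂ 2).boundary S) × ℝ | -1 < p.2 ∧ p.2 < 0} = univ ×ˢ Ioo (-1) 0 := by
    ext p
    exact ⟨fun h => ⟨trivial, h⟩, fun h => h.2⟩
  rw [hset]
  exact (hA.prod ((convex_Ioo (-1 : ℝ) 0).isPathConnected
    ⟨-2⁻¹, by norm_num, by norm_num⟩)).image c.continuous_seam

/-- `V ≅ 𝔻² ∖ ∂𝔻²` is contractible. [folklore] -/
theorem contractibleSpace_discSet : ContractibleSpace ↥c.discSet :=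
  haveI := contractibleSpace_interior_closedBall
  (c.G.d₂.isOpenEmbedding_inr.isEmbedding.toHomeomorph.symm :
    ↥c.discSet ≃ₜ InteriorManifold (𝓡∂ 2) (𝔻 2)).contractibleSpace

/-- `U` is connected (`S` connected): `jS(S)` and the seam collar meet. [folklore] -/
theorem isConnected_uSet [ConnectedSpace S] : IsConnected c.uSet := by
  rw [c.uSet_eq]
  obtain ⟨z⟩ := (inferInstance : Nonempty ((𝓡∂ 2).boundary S))
  haveI := c.connectedSpace_boundary
  have hz : c.jS (z : S) ∈ c.seam '' {p | -1 < p.2} :=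
    ⟨(z, 0), (by show (-1 : ℝ) < 0; norm_num), (c.jS_coe z).symm⟩
  refine IsConnected.union ⟨c.jS z, mem_range_self _, hz⟩
    (isConnected_range c.G.continuous_jM) ?_
  have hset : {p : ↥((𝓡∂ 2).boundary S) × ℝ | -1 < p.2} = univ ×ˢ Ioi (-1) := by
    ext p
    exact ⟨fun h => ⟨trivial, h⟩, fun h => h.2⟩
  rw [hset]
  exact (isConnected_univ.prod isConnected_Ioi).image _ c.continuous_seam.continuousOn

/-! #### The topological boundary collar of `W` -/

/-- The collar point `seam (z, s - 1) ∈ W` of level `s ∈ [0, 1]`. [folklore] -/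
def collarPt (q : ↥((𝓡∂ 2).boundary S) × I) : ↥c.wSet :=
  ⟨c.seam (q.1, (q.2 : ℝ) - 1),
    Or.inr ⟨(q.1, (q.2 : ℝ) - 1),
      ⟨(by linarith [unitInterval.nonneg q.2] : -1 ≤ (q.2 : ℝ) - 1),
        (by linarith [unitInterval.le_one q.2] : (q.2 : ℝ) - 1 ≤ 0)⟩, rfl⟩⟩

/-- The underlying point of `collarPt`. [folklore] -/
@[simp] theorem coe_collarPt (q : ↥((𝓡∂ 2).boundary S) × I) :
    (c.collarPt q : c.P) = c.seam (q.1, (q.2 : ℝ) - 1) := rfl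

/-- `collarPt` is continuous. [folklore] -/
theorem continuous_collarPt : Continuous c.collarPt :=
  (c.continuous_seam.comp (continuous_fst.prodMk
    ((continuous_subtype_val.comp continuous_snd).sub continuous_const))).subtype_mk _

/-- `collarPt` is injective. [folklore] -/
theorem collarPt_injective : Injective c.collarPt := by
  intro q q' h
  have h' := c.seam_injective (congrArg Subtype.val h)
  simp only [Prod.mk.injEq] at h'
  exact Prod.ext h'.1 (Subtype.ext (by linarith [h'.2]))

/-- The half-open collar `collarPt (∂S × [0, 1))` is the trace on `W` of the open seam set
`seam (∂S × (-∞, 0))`. [folklore] -/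
theorem image_collarPt_lt_one :
    c.collarPt '' {q | q.2 < 1} = Subtype.val ⁻¹' (c.seam '' {p | p.2 < 0}) := by
  ext w
  constructor
  · rintro ⟨q, hq, rfl⟩
    have hq' : (q.2 : ℝ) < 1 := hq
    have hm : (q.2 : ℝ) - 1 < 0 := by linarith
    exact ⟨(q.1, (q.2 : ℝ) - 1), hm, rfl⟩
  · rintro ⟨p, hp, hpw⟩
    have hp' : p.2 < 0 := hp
    rcases c.wSet_cases w.2 with hw | ⟨p', ⟨h1, -⟩, hp'w⟩
    · rw [← hpw] at hw
      exact absurd (c.seam_mem_range_jS_iff.1 hw) (not_le.2 hp')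
    · have hpp : p' = p := c.seam_injective (hp'w.trans hpw.symm)
      subst hpp
      have hlev : (0 : ℝ) ≤ p'.2 + 1 ∧ p'.2 + 1 ≤ 1 := ⟨by linarith, by linarith⟩
      refine ⟨(p'.1, ⟨p'.2 + 1, hlev⟩), ?_, ?_⟩
      · show p'.2 + 1 < 1
        linarith
      · apply Subtype.ext
        rw [coe_collarPt, ← hp'w]
        simp

variable [T2Space S] [CompactSpace S]

/-- **The seam collar is a topological boundary collar of `W`** (`BoundaryCollar`,
`CollarPush.lean`): `(z, s) ↦ seam (z, s - 1)` is a closed embedding `∂S × [0, 1] → W` (a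
continuous injection of a compact space into a Hausdorff space) whose half-open part
`seam (∂S × [-1, 0))` is open in `W`. [folklore] -/
def capCollar : BoundaryCollar ↥c.wSet ↥((𝓡∂ 2).boundary S) where
  collar := c.collarPt
  isClosedEmbedding_collar := by
    haveI := compactSpace_boundary₂ (S := S)
    exact c.continuous_collarPt.isClosedEmbedding c.collarPt_injective
  isOpen_image := by
    rw [c.image_collarPt_lt_one]
    exact (c.isOpenMap_seam _ (isOpen_lt continuous_snd continuous_const)).preimage
      continuous_subtype_val

/-- The collar map of `capCollar` is `collarPt`. [folklore] -/
@[simp] theorem capCollar_collar : c.capCollar.collar = c.collarPt := rfl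

/-- The open collar below level `1` is the trace of `seam (∂S × (-∞, 0))`. [folklore] -/
theorem capCollar_below_one :
    c.capCollar.below 1 = Subtype.val ⁻¹' (c.seam '' {p | p.2 < 0}) :=
  c.image_collarPt_lt_one

/-- **The core of `W` at level `1` is `jS(S)`.** [folklore] -/
theorem capCollar_core_one : c.capCollar.core 1 = Subtype.val ⁻¹' range c.jS := by
  ext w
  rw [BoundaryCollar.mem_core_iff, capCollar_below_one, mem_preimage, mem_preimage]
  constructor
  · intro hw
    rcases c.wSet_cases w.2 with h | ⟨p, ⟨-, h2⟩, hpw⟩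
    · exact h
    · exact (hw ⟨p, h2, hpw⟩).elim
  · rintro hw ⟨p, hp, hpw⟩
    rw [← hpw] at hw
    have hp' : p.2 < 0 := hp
    exact absurd (c.seam_mem_range_jS_iff.1 hw) (not_le.2 hp')

/-- **The interior of `W` (off the bottom `seam (∂S × {-1})` of the collar) is `U`.** [folklore] -/
theorem capCollar_interior : c.capCollar.interior = Subtype.val ⁻¹' c.uSet := by
  ext w
  rw [BoundaryCollar.mem_interior_iff, mem_preimage]
  constructor
  · intro hw
    rcases c.wSet_cases w.2 with h | ⟨p, ⟨h1, -⟩, hpw⟩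
    · exact c.range_jS_subset_uSet h
    · rcases h1.lt_or_eq with h1 | h1
      · rw [← hpw]
        exact c.seam_mem_uSet_iff.2 h1
      · exfalso
        refine hw p.1 (Subtype.ext ?_)
        rw [capCollar_collar, coe_collarPt, ← hpw]
        congr 1
        refine Prod.ext rfl ?_
        show ((0 : I) : ℝ) - 1 = p.2
        rw [← h1]
        norm_num
  · intro hw z hz
    have h := congrArg Subtype.val hz
    rw [capCollar_collar, coe_collarPt] at h
    rw [← h] at hw
    have h' := c.seam_mem_uSet_iff.1 hw
    norm_num at h'

/-- **The open strip of the collar below level `1` is `U ∩ V`.** [folklore] -/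
theorem capCollar_strip_one : c.capCollar.strip 1 = Subtype.val ⁻¹' (c.uSet ∩ c.discSet) := by
  rw [c.uSet_inter_discSet]
  ext w
  constructor
  · rintro ⟨q, ⟨h0, h1⟩, rfl⟩
    have h0' : (0 : ℝ) < q.2 := h0
    have h1' : (q.2 : ℝ) < 1 := h1
    have hm : -1 < (q.2 : ℝ) - 1 ∧ (q.2 : ℝ) - 1 < 0 := ⟨by linarith, by linarith⟩
    exact ⟨(q.1, (q.2 : ℝ) - 1), hm, rfl⟩
  · rintro ⟨p, ⟨h1, h2⟩, hpw⟩
    have hlev : (0 : ℝ) ≤ p.2 + 1 ∧ p.2 + 1 ≤ 1 := ⟨by linarith, by linarith⟩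
    refine ⟨(p.1, ⟨p.2 + 1, hlev⟩), ⟨?_, ?_⟩, ?_⟩
    · show (0 : ℝ) < p.2 + 1
      linarith
    · show p.2 + 1 < 1
      linarith
    · apply Subtype.ext
      rw [capCollar_collar, coe_collarPt, ← hpw]
      simp

/-! #### Homology of the pieces -/

/-- **`H_n(U; ℤ) ≅ H_n(S; ℤ)`**: `U ≅ interior(W) ≃ W ≃ core(W) = jS(S) ≅ S`, the two homotopy
equivalences being the collar pushes of `capCollar` (Hatcher 2002, Prop. 3.42). [cite: HatcherAT2002, Prop. 3.42] -/
def uSetHomologyIso (n : ℕ) : singularHomology ℤ ℤ ↥c.uSet n ≅ singularHomology ℤ ℤ S n :=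
  let κ := c.capCollar
  let e₁ : ↥c.uSet ≃ₜ ↥κ.interior :=
    (preimageValHomeomorphOfSubset c.uSet_subset_wSet).symm.trans
      (Homeomorph.setCongr c.capCollar_interior.symm)
  let e₂ : ↥κ.interior ≃ₕ ↥c.wSet := κ.interiorHomotopyEquiv (t := 1) zero_lt_one
  let e₃ : ↥(κ.core 1) ≃ₕ ↥c.wSet :=
    (κ.inclusionHomotopyEquiv 1 (κ.core 1) univ (subset_univ _)
      (fun _ _ _ hw => κ.push_mem_core_of_mem hw) (fun _ _ => mapsTo_univ _ _)
      (fun w _ => κ.push_mem_core 1 w)).trans (Homeomorph.Set.univ _).toHomotopyEquiv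
  let e₄ : ↥(κ.core 1) ≃ₜ ↥(range c.jS) :=
    (Homeomorph.setCongr c.capCollar_core_one).trans
      (preimageValHomeomorphOfSubset c.range_jS_subset_wSet)
  let e₅ : S ≃ₜ ↥(range c.jS) := c.isSmoothEmbedding_jS.isEmbedding.toHomeomorph
  singularHomology.mapIso ℤ ℤ e₁ n ≪≫ singularHomology.isoOfHomotopyEquiv ℤ ℤ e₂ n ≪≫
    (singularHomology.isoOfHomotopyEquiv ℤ ℤ e₃ n).symm ≪≫ singularHomology.mapIso ℤ ℤ e₄ n ≪≫
      (singularHomology.mapIso ℤ ℤ e₅ n).symm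

/-- **`H_n(U ∩ V; ℤ) ≅ H_n(𝕊¹; ℤ)`**: `U ∩ V` is the open strip `seam (∂S × (-1, 0))` of the
collar, homotopy equivalent to a slice `∂S ≅ 𝕊¹` (`BoundaryCollar.stripHomotopyEquiv`). [folklore] -/
def interHomologyIso (n : ℕ) :
    singularHomology ℤ ℤ ↥(c.uSet ∩ c.discSet) n ≅ singularHomology ℤ ℤ (𝕊 1) n :=
  let κ := c.capCollar
  let e₁ : ↥(c.uSet ∩ c.discSet) ≃ₜ ↥(κ.strip 1) :=
    (preimageValHomeomorphOfSubset (inter_subset_left.trans c.uSet_subset_wSet)).symm.trans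
      (Homeomorph.setCongr c.capCollar_strip_one.symm)
  let e₂ : ↥((𝓡∂ 2).boundary S) ≃ₕ ↥(κ.strip 1) :=
    κ.stripHomotopyEquiv levelHalf_pos levelHalf_lt_one
  let e₃ : ↥((𝓡∂ 2).boundary S) ≃ₜ ↥(𝕊 1) := c.φS.toHomeomorph
  singularHomology.mapIso ℤ ℤ e₁ n ≪≫ (singularHomology.isoOfHomotopyEquiv ℤ ℤ e₂ n).symm ≪≫
    singularHomology.mapIso ℤ ℤ e₃ n

/-- `rank H₁(U ∩ V; ℤ) = 1` and `H₁(U ∩ V; ℤ)` is finitely generated (`H₁(𝕊¹) ≅ ℤ`, Hatcher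
Cor. 2.14). [folklore] -/
theorem finrank_singularHomology_inter_one :
    Module.finrank ℤ (singularHomology ℤ ℤ ↥(c.uSet ∩ c.discSet) 1) = 1 ∧
      Module.Finite ℤ (singularHomology ℤ ℤ ↥(c.uSet ∩ c.discSet) 1) := by
  obtain ⟨e⟩ := nonempty_singularHomology_sphere_iso_holds ℤ ℤ (n := 1) le_rfl
  exact finrank_eq_one_of_iso_ulift (c.interHomologyIso 1 ≪≫ e)

/-- `H₂(U ∩ V; ℤ) = 0` (`H₂(𝕊¹) = 0`, Hatcher Cor. 2.14). [folklore] -/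
theorem isZero_singularHomology_inter_two : IsZero (singularHomology ℤ ℤ ↥(c.uSet ∩ c.discSet) 2) :=
  (isZero_singularHomology_sphere_holds ℤ ℤ (n := 1) (k := 2) two_ne_zero (by norm_num)).of_iso
    (c.interHomologyIso 2)

omit [CompactSpace S] in
/-- **`U` is not compact** (`S` connected): it is a proper non-empty open subset of the connected
Hausdorff surface `P` (the bottom `seam (∂S × {-1})` of the collar is missing), and it would be
closed if it were compact. [folklore] -/
theorem noncompactSpace_uSet [ConnectedSpace S] : NoncompactSpace ↥c.uSet := by
  haveI := c.connectedSpace_P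
  rw [← not_compactSpace_iff]
  intro hc
  have hK : IsCompact c.uSet := isCompact_iff_compactSpace.2 hc
  obtain ⟨z⟩ := (inferInstance : Nonempty ((𝓡∂ 2).boundary S))
  rcases isClopen_iff.1 ⟨hK.isClosed, c.isOpen_uSet⟩ with h | h
  · have hz : c.jS (z : S) ∈ c.uSet := c.range_jS_subset_uSet (mem_range_self _)
    rw [h] at hz
    simp at hz
  · have hz : c.seam (z, -1) ∈ c.uSet := by
      rw [h]
      exact mem_univ _
    exact lt_irrefl _ (c.seam_mem_uSet_iff.1 hz)

omit [CompactSpace S] in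
/-- **`H₂(U; ℤ) = 0`** (`S` connected): `U` is a connected non-compact surface (an open subset of
`P`), Hatcher 2002, Prop. 3.29 (`isZero_singularHomology_of_noncompactSpace_holds`).
[cite: HatcherAT2002, Prop. 3.29] -/
theorem isZero_singularHomology_uSet_two [ConnectedSpace S] :
    IsZero (singularHomology ℤ ℤ ↥c.uSet 2) := by
  haveI : ChartedSpace (𝔼 2) ↥c.uSet :=
    inferInstanceAs (ChartedSpace (𝔼 2) ↥(⟨c.uSet, c.isOpen_uSet⟩ : TopologicalSpace.Opens c.P))
  haveI : ConnectedSpace ↥c.uSet := isConnected_iff_connectedSpace.1 c.isConnected_uSet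
  haveI := c.noncompactSpace_uSet
  exact isZero_singularHomology_of_noncompactSpace_holds ℤ (↥c.uSet) 2 le_rfl

/-- `rank H₂(P; ℤ) = 1` for the capped surface of a connected `S`, given a homological
`ℤ`-orientation (Hatcher 2002, Thm. 3.26: `H₂(P; ℤ) ≅ ℤ`). [cite: HatcherAT2002, Thm. 3.26] -/
theorem finrank_singularHomology_P_two [ConnectedSpace S] (μ : HomologicalOrientation ℤ c.P 2) :
    Module.finrank ℤ (singularHomology ℤ ℤ c.P 2) = 1 := by
  haveI := c.connectedSpace_P
  obtain ⟨e⟩ := nonempty_singularHomology_top_iso_holds (R := ℤ) (X := c.P) 2 μ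
  exact (finrank_eq_one_of_iso_ulift e).1

/-- **`rank H₁(S ∪_φ 𝔻²; ℤ) = rank H₁(S; ℤ)`** for a compact connected surface `S` with one
boundary circle, capped by a disc (Hirsch 1976, Ch. 9 §3, proof of Thm. 3.7; Massey 1991, Ch. I
§10), granted a homological `ℤ`-orientation of the capped surface: Mayer–Vietoris for
`P = U ∪ V` (Hatcher 2002, §2.2) with `H₂(U) = H₂(V) = H₁(V) = 0`, `H₂(P) ≅ H₁(U ∩ V) ≅ ℤ`,
`H₀(U ∩ V) ↪ H₀(U)`, and `H₁(U) ≅ H₁(S)`. [cite: HirschDT1976, Ch. 9 §3, Thm. 3.7 (proof)]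
[cite: HatcherAT2002, §2.2 pp. 149–150 and Thm. 2.44] -/
theorem finrank_singularHomology_one_eq [ConnectedSpace S] (μ : HomologicalOrientation ℤ c.P 2) :
    Module.finrank ℤ (singularHomology ℤ ℤ c.P 1) = Module.finrank ℤ (singularHomology ℤ ℤ S 1) := by
  have hexc := relativeSingularHomology.isIso_map_of_interior_union_interior_holds ℤ ℤ c.P
  have hcov := c.interior_uSet_union_interior_discSet
  haveI : ContractibleSpace ↥c.discSet := c.contractibleSpace_discSet
  -- vanishing of `H₂(U)`, `H₂(V)`, `H₁(V)`
  have hU2 := c.isZero_singularHomology_uSet_two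
  have hV2 : IsZero (singularHomology ℤ ℤ ↥c.discSet 2) :=
    isZero_singularHomology_of_contractibleSpace ℤ ℤ two_ne_zero
  have hV1 : IsZero (singularHomology ℤ ℤ ↥c.discSet 1) :=
    isZero_singularHomology_of_contractibleSpace ℤ ℤ one_ne_zero
  -- `δ : H₂(P) → H₁(U ∩ V)` is injective
  have hψ2 : mayerVietoris.ψ ℤ ℤ c.uSet c.discSet 2 = 0 := by
    refine biprod.hom_ext' _ _ ?_ ?_
    · rw [comp_zero]
      exact hU2.eq_of_src _ _
    · rw [comp_zero]
      exact hV2.eq_of_src _ _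
  haveI : Mono (mayerVietoris.δ ℤ ℤ c.uSet c.discSet hexc hcov 1) :=
    (mayerVietoris.exact₂_holds ℤ ℤ c.uSet c.discSet hexc hcov 1).mono_g hψ2
  -- `ψ : H₁(U) ⊕ H₁(V) → H₁(P)` is surjective, as `H₀(U ∩ V) → H₀(U) ⊕ H₀(V)` is injective
  haveI : PathConnectedSpace ↥(c.uSet ∩ c.discSet) :=
    isPathConnected_iff_pathConnectedSpace.1 c.isPathConnected_inter
  haveI : Mono (mayerVietoris.φ ℤ ℤ c.uSet c.discSet 0) := by
    haveI := singularHomology.mono_map_zero_of_pathConnectedSpace ℤ ℤ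
      (subsetInclusion (inter_subset_left : c.uSet ∩ c.discSet ⊆ c.uSet))
    exact mono_of_mono_fac (biprod.lift_fst _ _)
  have hδ0 : mayerVietoris.δ ℤ ℤ c.uSet c.discSet hexc hcov 0 = 0 :=
    zero_of_comp_mono _ (mayerVietoris.δ_comp_φ ℤ ℤ c.uSet c.discSet hexc hcov 0)
  haveI : Epi (mayerVietoris.ψ ℤ ℤ c.uSet c.discSet 1) :=
    (mayerVietoris.exact₂_holds ℤ ℤ c.uSet c.discSet hexc hcov 0).epi_f hδ0
  -- finiteness of `H₁(U ∩ V)` and `H₁(U) ⊕ H₁(V)`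
  obtain ⟨hUV1, hUV1f⟩ := c.finrank_singularHomology_inter_one
  haveI := hUV1f
  haveI : Module.Finite ℤ (singularHomology ℤ ℤ S 1) :=
    finite_singularHomology_of_compact_chartedSpace_halfSpace ℤ ℤ (n := 1) (W := S) 1
  haveI : Module.Finite ℤ (singularHomology ℤ ℤ ↥c.uSet 1) :=
    Module.Finite.equiv (c.uSetHomologyIso 1).toLinearEquiv.symm
  haveI : Module.Finite ℤ (singularHomology ℤ ℤ ↥c.discSet 1) := moduleFinite_of_isZero hV1
  haveI : Module.Finite ℤ (singularHomology ℤ ℤ ↥c.uSet 1 ⊞ singularHomology ℤ ℤ ↥c.discSet 1 :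
      ModuleCat.{0} ℤ) := moduleFinite_biprod
  -- the rank count along `0 → H₂(P) → H₁(U ∩ V) → H₁(U) ⊕ H₁(V) → H₁(P) → 0`
  have key := finrank_add_finrank_eq_of_exact₄
    (mayerVietoris.δ_comp_φ ℤ ℤ c.uSet c.discSet hexc hcov 1)
    (mayerVietoris.exact₃_holds ℤ ℤ c.uSet c.discSet hexc hcov 1)
    (mayerVietoris.φ_comp_ψ ℤ ℤ c.uSet c.discSet 1)
    (mayerVietoris.exact₁_holds ℤ ℤ c.uSet c.discSet hcov 1)
  have hA : Module.finrank ℤ (singularHomology ℤ ℤ c.P (1 + 1)) = 1 :=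
    c.finrank_singularHomology_P_two μ
  have hC : Module.finrank ℤ (singularHomology ℤ ℤ ↥c.uSet 1 ⊞ singularHomology ℤ ℤ ↥c.discSet 1 :
      ModuleCat.{0} ℤ) = Module.finrank ℤ (singularHomology ℤ ℤ ↥c.uSet 1) :=
    finrank_biprod_of_isZero_right hV1
  have hU : Module.finrank ℤ (singularHomology ℤ ℤ ↥c.uSet 1) =
      Module.finrank ℤ (singularHomology ℤ ℤ S 1) :=
    (c.uSetHomologyIso 1).toLinearEquiv.finrank_eq
  omega

end CapData

end Cap

/-! ### Discharge of the named fact -/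

/-- **Discharge of `even_finrank_singularHomology_one_of_boundary_circle`** (Hirsch 1976, Ch. 9
§3, Thm. 3.7, the parity clause for one boundary circle): the first Betti number of a compact
connected orientable smooth surface `S` with `∂S ≅ 𝕊¹` is even.  Proof: cap `S` by a disc
(`CapData`); the capped surface `P` is a closed connected orientable surface
(`CapData.isOrientable_P`), hence `ℤ`-oriented (`isOrientableOver_int_of_isOrientable_holds`), so
`rank H₁(P; ℤ)` is even (`even_finrank_singularHomology_one_of_orientation`, Poincaré duality),
and `rank H₁(P; ℤ) = rank H₁(S; ℤ)` (`CapData.finrank_singularHomology_one_eq`).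
[cite: HirschDT1976, Ch. 9 §3, Thm. 3.7 (k = 1)] -/
theorem even_finrank_singularHomology_one_of_boundary_circle_holds :
    even_finrank_singularHomology_one_of_boundary_circle := by
  intro S _ _ _ _ _ _ _ e ho
  haveI : Nonempty ((𝓡∂ 2).boundary S) := ⟨e.symm ⟨EuclideanSpace.single 0 1, by simp⟩⟩
  obtain ⟨c⟩ := CapData.nonempty e ho
  haveI := c.connectedSpace_P
  obtain ⟨μ⟩ := isOrientableOver_int_of_isOrientable_holds (X := c.P) (n := 2) (c.isOrientable_P ho)
  rw [← c.finrank_singularHomology_one_eq μ]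
  exact even_finrank_singularHomology_one_of_orientation μ

end Literature.Topology.FourManifolds
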